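import Literature.Geometry.Kaehler.DDcPowRadial
import Literature.Geometry.Kaehler.TwoFormTransgression
import Literature.Geometry.Kaehler.AnalyticSetChain
import HarnessLib

/-!
# Radial Monge–Ampère densities on the carrier of a holomorphic chain

Let `T` be a holomorphic `p`-chain (`p ≥ 1`) on an open subset `Ω` of a finite-dimensional complex
inner product space `V`, with carrier `reg|T|` and canonical orientation frame `ξ_T` (at every
carrier point the real frame `(u₀, i u₀, …)` of a unitary frame `u` of the tangent `p`-plane,
`exists_orientationFrame_eq_complexFrame`). For a centre `a ∈ V` and a radial weight
`w(z) = F(‖z - a‖²)`, `F` of class `C²`, the Monge–Ampère density of `[T] ∧ (dd^c w)ᵖ` at a carrier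
point `z` is (`DDcPowRadial.lean`, translated to `a`)

`(dd^c w)(z)ᵖ(ξ_T(z)) = p! 4ᵖ F'^{p-1} (F' + F'' τ_T(a, z))`,  `F', F''` at `‖z - a‖²`,

(`HolomorphicChain.twoPow_ddcForm_radial_orientationFrame`) with the **tangential square**
`τ_T(a, z) = Σ_k Re⟨ξ_T(z)_k, z - a⟩² = ‖pr_{T_z} (z - a)‖² ∈ [0, ‖z - a‖²]`
(`HolomorphicChain.tangentialSq`, `tangentialSq_le`). Measurability: pairings
`z ↦ Φ(z)(ξ_T(z))` of continuous covector fields with the orientation are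
`𝓗^{2p} ⌞ reg|T|`-a.e. strongly measurable (`aestronglyMeasurable_apply_orientationFrame`, from
`aestronglyMeasurable_frameVector_orientationFrame`), in particular the Monge–Ampère densities of
smooth weights (`aestronglyMeasurable_twoPow_ddcForm_orientationFrame`); and `τ_T(a, ·)` is
`𝓗^{2p} ⌞ reg|T|`-a.e. measurable, being read off from the density of the quartic weight
`‖z - a‖⁴`: `τ = (dd^c ‖·-a‖⁴)ᵖ(ξ)/(p! 8ᵖ ‖z-a‖^{2(p-1)}) - ‖z-a‖²` off `z = a`
(`aemeasurable_tangentialSq`). These are the pointwise inputs of the Monge–Ampère computation of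
Lelong numbers [Chirka1989, §15.1]; [Demailly, Ch. III §5–7].

## References

* E. M. Chirka, *Complex Analytic Sets*, Kluwer 1989, §14.1, §15.1 [Chirka1989].
* J.-P. Demailly, *Complex analytic and differential geometry*, Ch. III §5.
-/

noncomputable section

open scoped Manifold Topology ENNReal InnerProductSpace ContDiff
open Set Filter MeasureTheory Complex Module

namespace Literature.Geometry.Kaehler

open Literature.Geometry.GeometricMeasureTheory TwoForm

universe u

variable {V : Type u} [NormedAddCommGroup V] [InnerProductSpace ℂ V]

/-! ### Translating weights -/

/-- `d^c` of a translated function is the translated `d^c`. [folklore] -/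
theorem dcForm_comp_sub (f : V → ℝ) (a x : V) : dcForm (fun z => f (z - a)) x = dcForm f (x - a) := by
  ext v
  simp [dcForm_apply, fderiv_comp_sub]

/-- `dd^c` of a translated function is the translated `dd^c`. [folklore] -/
theorem ddcForm_comp_sub (f : V → ℝ) (a x : V) : ddcForm (fun z => f (z - a)) x = ddcForm f (x - a) := by
  have h1 : dcForm (fun z => f (z - a)) = fun y => dcForm f (y - a) := funext (dcForm_comp_sub f a)
  rw [ddcForm_def, ddcForm_def, h1]
  simp only [extDeriv]
  rw [fderiv_comp_sub]

variable [FiniteDimensional ℂ V] [MeasurableSpace V] [BorelSpace V]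
  {Ω : TopologicalSpace.Opens V} {p : ℕ}

namespace HolomorphicChain

/-! ### The tangential square `τ_T(a, z)` -/

/-- The **tangential square** of `z - a` along the carrier of `T`:
`τ_T(a, z) = Σ_k Re⟨ξ_T(z)_k, z - a⟩²`, the squared norm of the orthogonal projection of `z - a` to
the tangent `p`-plane at a carrier point `z` (read through the slots of the orientation frame, so
that it is a function of `z` alone). [cite: Chirka1989, §15.1] -/
def tangentialSq (T : HolomorphicChain 𝓘(ℂ, V) Ω p) (a z : V) : ℝ :=
  ∑ k, (⟪T.orientationFrame z k, z - a⟫_ℂ).re ^ 2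

omit [FiniteDimensional ℂ V] in
/-- `τ_T(a, z) = Σⱼ |⟨z - a, uⱼ⟩|²` for the unitary frame `u` behind the orientation. [folklore] -/
theorem tangentialSq_eq_of_eq_complexFrame (T : HolomorphicChain 𝓘(ℂ, V) Ω p) {a z : V}
    {u : Fin p → V} (h : T.orientationFrame z = complexFrame u) :
    T.tangentialSq a z = ∑ i, ‖⟪z - a, u i⟫_ℂ‖ ^ 2 := by
  rw [tangentialSq, h, sum_sq_re_inner_complexFrame]

omit [FiniteDimensional ℂ V] in
/-- `τ_T ≥ 0`. [folklore] -/
theorem tangentialSq_nonneg (T : HolomorphicChain 𝓘(ℂ, V) Ω p) (a z : V) : 0 ≤ T.tangentialSq a z :=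
  Finset.sum_nonneg fun _ _ => sq_nonneg _

/-- `τ_T(a, z) ≤ ‖z - a‖²` at carrier points (Bessel). [folklore] -/
theorem tangentialSq_le (T : HolomorphicChain 𝓘(ℂ, V) Ω p) (a : V) {z : V} (hz : z ∈ T.carrier) :
    T.tangentialSq a z ≤ ‖z - a‖ ^ 2 := by
  obtain ⟨u, hu, hξ⟩ := T.exists_orientationFrame_eq_complexFrame hz
  rw [T.tangentialSq_eq_of_eq_complexFrame hξ]
  exact sum_norm_sq_inner_le hu _

/-! ### The radial Monge–Ampère density on the carrier -/

/-- **Radial Monge–Ampère density along a holomorphic chain.** For `F` of class `C²`, `p ≥ 1`,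
a centre `a` and a carrier point `z` of the `p`-chain `T`,
`(dd^c F(‖·-a‖²))(z)ᵖ(ξ_T(z)) = p! 4ᵖ F'(t)^{p-1} (F'(t) + F''(t) τ_T(a,z))`, `t = ‖z - a‖²`.
[cite: Chirka1989, §15.1] -/
theorem twoPow_ddcForm_radial_orientationFrame (T : HolomorphicChain 𝓘(ℂ, V) Ω p) {F : ℝ → ℝ}
    (hF : ContDiff ℝ 2 F) (hp : 0 < p) (a : V) {z : V} (hz : z ∈ T.carrier) :
    (ddcForm (fun y : V => F (‖y - a‖ ^ 2)) z).twoPow p (T.orientationFrame z) =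
      p.factorial * 4 ^ p * deriv F (‖z - a‖ ^ 2) ^ (p - 1) *
        (deriv F (‖z - a‖ ^ 2) + deriv (deriv F) (‖z - a‖ ^ 2) * T.tangentialSq a z) := by
  obtain ⟨u, hu, hξ⟩ := T.exists_orientationFrame_eq_complexFrame hz
  rw [ddcForm_comp_sub (fun y : V => F (‖y‖ ^ 2)) a z, hξ,
    twoPow_ddcForm_comp_norm_sq_complexFrame hF hp (z - a) hu, T.tangentialSq_eq_of_eq_complexFrame hξ]

/-- The quartic case `F(t) = t²`: `(dd^c ‖·-a‖⁴)(z)ᵖ(ξ_T(z)) = p! 8ᵖ t^{p-1} (t + τ_T(a,z))`,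
`t = ‖z - a‖²`. [folklore] -/
theorem twoPow_ddcForm_norm_sub_pow_four_orientationFrame (T : HolomorphicChain 𝓘(ℂ, V) Ω p)
    (hp : 0 < p) (a : V) {z : V} (hz : z ∈ T.carrier) :
    (ddcForm (fun y : V => (‖y - a‖ ^ 2) ^ 2) z).twoPow p (T.orientationFrame z) =
      p.factorial * 8 ^ p * (‖z - a‖ ^ 2) ^ (p - 1) * (‖z - a‖ ^ 2 + T.tangentialSq a z) := by
  have hF : ContDiff ℝ 2 (fun t : ℝ => t ^ 2) := contDiff_id.pow 2
  rw [T.twoPow_ddcForm_radial_orientationFrame hF hp a hz]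
  have hd : deriv (fun t : ℝ => t ^ 2) = fun t => 2 * t := by
    funext t
    rw [(hasDerivAt_pow 2 t).deriv]
    norm_num
  have hdd : deriv (deriv (fun t : ℝ => t ^ 2)) = fun _ => 2 := by
    rw [hd]
    funext t
    have h2 : HasDerivAt (fun t : ℝ => 2 * t) (2 * 1) t := (hasDerivAt_id t).const_mul (2 : ℝ)
    rw [h2.deriv, mul_one]
  rw [hdd, hd]
  beta_reduce
  obtain ⟨q, rfl⟩ := Nat.exists_eq_add_of_le' hp
  simp only [Nat.add_sub_cancel, mul_pow]
  rw [show (8 : ℝ) ^ (q + 1) = 4 ^ (q + 1) * 2 ^ (q + 1) by rw [← mul_pow]; norm_num, pow_succ (2 : ℝ) q]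
  ring

/-! ### Measurability along the carrier -/

/-- **Pairings of continuous covector fields with the orientation are a.e. strongly measurable**
on `𝓗^{2p} ⌞ reg|T|`. [folklore] -/
theorem aestronglyMeasurable_apply_orientationFrame (T : HolomorphicChain 𝓘(ℂ, V) Ω p)
    {Φ : V → Covector V (2 * p)} (hΦ : Continuous Φ) :
    AEStronglyMeasurable (fun z => Φ z (T.orientationFrame z))
      ((μHE[2 * p] : Measure V).restrict T.carrier) := by
  have h := (isBoundedBilinearMap_apply (𝕜 := ℝ) (E := Covector V (2 * p)) (F := ℝ)).continuous
    |>.comp_aestronglyMeasurable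
      (T.aestronglyMeasurable_frameVector_orientationFrame.prodMk hΦ.aestronglyMeasurable)
  exact h

omit [FiniteDimensional ℂ V] [MeasurableSpace V] [BorelSpace V] in
/-- The Monge–Ampère covector field `z ↦ (dd^c w)(z)ᵖ` of a smooth weight is continuous. [folklore] -/
theorem continuous_twoPow_ddcForm {w : V → ℝ} (hw : ContDiff ℝ ∞ w) (p : ℕ) :
    Continuous fun z => (ddcForm w z).twoPow p := by
  have hw2 : ContDiff ℝ 2 w := by exact_mod_cast contDiff_infty.1 hw 2
  have h2 : ContDiff ℝ 0 (ddcForm w) := contDiff_ddcForm hw2 (le_of_eq (by norm_num))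
  exact (contDiff_twoPow h2 p).continuous

/-- **Monge–Ampère densities of smooth weights are a.e. strongly measurable along the carrier.**
[folklore] -/
theorem aestronglyMeasurable_twoPow_ddcForm_orientationFrame (T : HolomorphicChain 𝓘(ℂ, V) Ω p)
    {w : V → ℝ} (hw : ContDiff ℝ ∞ w) :
    AEStronglyMeasurable (fun z => (ddcForm w z).twoPow p (T.orientationFrame z))
      ((μHE[2 * p] : Measure V).restrict T.carrier) :=
  T.aestronglyMeasurable_apply_orientationFrame (continuous_twoPow_ddcForm hw p)

omit [InnerProductSpace ℂ V] [FiniteDimensional ℂ V] in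
/-- Singletons are `𝓗^{2p}`-null for `p ≥ 1`. [folklore] -/
theorem euclideanHausdorffMeasure_singleton (hp : 0 < p) (x : V) :
    (μHE[2 * p] : Measure V) {x} = 0 := by
  haveI := Measure.nullSingletonClass_hausdorff V (d := ((2 * p : ℕ) : ℝ)) (by positivity)
  have h0 : (μH[((2 * p : ℕ) : ℝ)] : Measure V) {x} = 0 := measure_singleton x
  rw [Measure.euclideanHausdorffMeasure_def, Measure.coe_nnreal_smul_apply, h0, mul_zero]

/-- **The tangential square is a.e. measurable along the carrier** (it is read off from the
Monge–Ampère density of the quartic weight off the centre). [folklore] -/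
theorem aemeasurable_tangentialSq (T : HolomorphicChain 𝓘(ℂ, V) Ω p) (hp : 0 < p) (a : V) :
    AEMeasurable (T.tangentialSq a) ((μHE[2 * p] : Measure V).restrict T.carrier) := by
  set g : V → ℝ := fun z =>
    (ddcForm (fun y : V => (‖y - a‖ ^ 2) ^ 2) z).twoPow p (T.orientationFrame z) *
      ((p.factorial : ℝ) * 8 ^ p * (‖z - a‖ ^ 2) ^ (p - 1))⁻¹ - ‖z - a‖ ^ 2 with hg
  have hw : ContDiff ℝ ∞ fun y : V => (‖y - a‖ ^ 2) ^ 2 :=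
    ((contDiff_norm_sq ℂ).comp (contDiff_id.sub contDiff_const)).pow 2
  have hc : Measurable fun z : V => ((p.factorial : ℝ) * 8 ^ p * (‖z - a‖ ^ 2) ^ (p - 1))⁻¹ :=
    (Continuous.measurable (by fun_prop)).inv
  have hn : Continuous fun z : V => ‖z - a‖ ^ 2 := by fun_prop
  have hgm : AEStronglyMeasurable g ((μHE[2 * p] : Measure V).restrict T.carrier) :=
    ((T.aestronglyMeasurable_twoPow_ddcForm_orientationFrame hw).mul hc.aestronglyMeasurable).sub
      hn.aestronglyMeasurable
  refine hgm.aemeasurable.congr ?_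
  -- `g = τ` on the carrier off the centre `a`
  have hnull : ((μHE[2 * p] : Measure V).restrict T.carrier) {a} = 0 :=
    le_antisymm ((Measure.restrict_apply_le _ _).trans
      (euclideanHausdorffMeasure_singleton hp a).le) zero_le
  have hae : ∀ᵐ z ∂((μHE[2 * p] : Measure V).restrict T.carrier), z ≠ a := by
    rw [ae_iff]
    simpa using hnull
  filter_upwards [hae, ae_restrict_mem T.measurableSet_carrier] with z hza hz
  rw [hg]
  simp only
  rw [T.twoPow_ddcForm_norm_sub_pow_four_orientationFrame hp a hz]
  have ht : (‖z - a‖ ^ 2) ≠ 0 := pow_ne_zero _ (norm_ne_zero_iff.2 (sub_ne_zero.2 hza))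
  have hc' : (p.factorial : ℝ) * 8 ^ p * (‖z - a‖ ^ 2) ^ (p - 1) ≠ 0 := by positivity
  field_simp
  ring

end HolomorphicChain

end Literature.Geometry.Kaehler

end
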